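import Literature.NumberTheory.Automorphic.UnitaryTwoEulerPoincareEllipticTypeTwo        -- ★ B-p08 (g28) p843401: the type-(2) `(E)`-relation in hypothesis form
import Literature.NumberTheory.Rogawski1990.LocalIrreducibleTorusDiscriminantOdd       -- ★ `exists_valued_disc_eq_exp_neg_odd_of_not_exists_isRoot` (odd order of the discriminant)
import Literature.NumberTheory.GaloisCohomology.KummerClassLocalPower                  -- ★ Hensel: `exists_eq_pow_of_valuation_sub_one_lt`
import HarnessLib

/-!
# The type-(2) side conditions DISCHARGED: integral trace, unit determinant, odd discriminant — and Kottwitz's type-(2) relation from `hirr` alone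

Topic `NumberTheory/Automorphic`, namespace `Literature.NumberTheory.Automorphic` (§1) ∕ `….UnitaryGroup` (§2–§3).  THEOREMS ONLY: no definition, no named fact,
no instance, no notation, no `sorry`; kernel lane.  Brick (R5c″) of the (R2) Euler–Poincaré road for `stub_N6nsR2EP : RankOneEulerPoincareNonsplit` (assembler
B-p14 (g32); LEAD F0P3a-plan (g10) WORD T9-8 (C)); seat B-p08 (g28).  HONEST LABEL: HC_CM is proved only modulo the cell's remaining named inputs (hLiu418, h413)
until rung 0 closes; (R2) is a printed theorem [Kottwitz1988 §2 Thm 2] — this file removes the last type-(2) hypotheses of its in-house unramified road.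

THE MATHEMATICS.  ★ (R5c′) `natCard_fixedBy_add_eq_natCard_fixedBy_add_one_of_not_exists_isRoot` needs, for `γ ∈ U₂` with ROOTLESS `χ_{γ,w}` over `L_w`:
`|2|_w = 1`, `tr γ_w ∈ 𝒪_w`, and `|tr² − 4det|_w = exp(−(2N+1))`.  All three follow from `hirr` and unitarity at an inert `v ∤ 2`:
* §1 (any non-archimedean local field `E`, `|2| = 1`) **`valuation_trace_le_one_of_not_exists_isRoot`**: if `|det g| ≤ 1` and `χ_g` has no root then `|tr g| ≤ 1` —
  otherwise `x = 1 − 4 det∕tr²` is a principal unit, hence a square `s²` (HENSEL ★ `exists_eq_pow_of_valuation_sub_one_lt`), and `(tr + tr·s)∕2` is a root of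
  `X² − tr X + det` [Serre1979, Ch. XIV §4; Neukirch ANT II (5.7)];
* §2 (at `w`) `valuation_det_eq_one_of_mem` — `σ_w(det γ)·det γ = 1` for `γ ∈ U(σ_w, (Φ₂)_w)` (★ `det_mul_map_det_eq_one`-style identity from `ᵗσ(γ)Φ₂γ = Φ₂`), so
  `|det γ_w| = 1` (★ `valuation_eq_one_of_galAdicCompletionMap_mul_self`); **`typeTwo_sideConditions_of_not_exists_isRoot`** packages `|2| = 1`, `tr ∈ 𝒪`,
  `∃ N, |tr² − 4det| = exp(−(2N+1))` (★ `Rogawski1990.exists_valued_disc_eq_exp_neg_odd_of_not_exists_isRoot` at the pair `(γ, 1)`);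
* §3 **`natCard_fixedBy_add_eq_natCard_fixedBy_add_one_of_not_exists_isRoot'`** — Kottwitz's type-(2) relation `#Fix(U₂⧸C) + #Fix(U₂⧸C′) = #Fix(U₂⧸I) + 1` from
  `(hunr) (h2 : IsUnit (2 : 𝒪_w)) (ϖ) (hσϖ) (C C′ I) (hC hC′ hI) (γ) (hirr)` ALONE: the glue's elliptic binder `hE` for the rootless branch of ★ p842953's trichotomy.

## References
* [Kottwitz1988] R. E. Kottwitz, *Tamagawa numbers*, Ann. of Math. 127 (1988), 629–646, §2 Theorem 2.
* [Serre1979] J.-P. Serre, *Local Fields*, GTM 67 (1979), Ch. XIV §4 (Hensel; principal units are squares away from 2).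
* [NeukirchANT1999] J. Neukirch, *Algebraic Number Theory* (1999), Ch. II (5.7)–(5.8).
* [Rogawski1990] J. D. Rogawski, *Automorphic Representations of Unitary Groups in Three Variables* (1990), §3.6 p. 31 (the anisotropic tori `(EK)¹`).
-/

set_option autoImplicit false

noncomputable section

open scoped ValuativeRel Matrix MatrixGroups
open Matrix ValuativeRel Finset NumberField IsDedekindDomain MulAction

namespace Literature.NumberTheory.Automorphic

/-! ## §1 Hensel: a rootless `2 × 2` characteristic polynomial with integral determinant has integral trace -/

section LocalField

variable {E : Type*} [Field E] [ValuativeRel E] [TopologicalSpace E] [IsNonarchimedeanLocalField E]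

/-- **`|det g| ≤ 1`, `χ_g` rootless, `|2| = 1` ⇒ `|tr g| ≤ 1`.**  If `|t| > 1` (`t = tr g`, `d = det g`) then `x := 1 − 4d∕t²` satisfies `|x − 1| = |4d∕t²| < 1`, so
`x = s²` (Hensel, ★ `exists_eq_pow_of_valuation_sub_one_lt`) and `r := (t + t s)∕2` satisfies `r² − t r + d = 0`: a root of `χ_g = X² − tX + d`.
[cite: Serre1979, Ch. XIV §4] [cite: NeukirchANT1999, Ch. II §5 (5.7)] -/
theorem valuation_trace_le_one_of_not_exists_isRoot (h2 : valuation E (2 : E) = 1) (g : Matrix (Fin 2) (Fin 2) E)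
    (hdet : valuation E g.det ≤ 1) (hirr : ¬ ∃ x : E, (g.charpoly).IsRoot x) : valuation E g.trace ≤ 1 := by
  by_contra hgt
  rw [not_le] at hgt
  have h20 : (2 : E) ≠ 0 := fun h => by rw [h, map_zero] at h2; exact zero_ne_one h2
  have ht0 : g.trace ≠ 0 := fun h => by rw [h, map_zero] at hgt; exact not_lt_zero hgt
  have h4 : valuation E (4 : E) = 1 := by rw [show (4 : E) = 2 * 2 by norm_num, map_mul, h2, one_mul]
  -- `x = 1 − 4d∕t²` is a principal unit
  have hx : valuation E ((1 - 4 * g.det / g.trace ^ 2) - 1) < 1 := by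
    rw [sub_sub_cancel_left, Valuation.map_neg, map_div₀, map_mul, h4, one_mul, map_pow]
    have ht1 : (1 : ValueGroupWithZero E) < valuation E g.trace ^ 2 := by
      calc (1 : ValueGroupWithZero E) = 1 * 1 := (mul_one 1).symm
        _ < valuation E g.trace * valuation E g.trace := mul_lt_mul'' hgt hgt zero_le_one zero_le_one
        _ = valuation E g.trace ^ 2 := (sq _).symm
    have hpos : (0 : ValueGroupWithZero E) < valuation E g.trace ^ 2 := lt_trans zero_lt_one ht1
    rw [div_lt_one₀ hpos]
    exact lt_of_le_of_lt hdet ht1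
  obtain ⟨s, hs⟩ := Literature.NumberTheory.GaloisCohomology.exists_eq_pow_of_valuation_sub_one_lt E 2 (by rw [Nat.cast_ofNat]; exact h2) hx
  -- the root `(t + t s) ∕ 2`
  refine hirr ⟨(g.trace + g.trace * s) * 2⁻¹, ?_⟩
  rw [Polynomial.IsRoot, Matrix.charpoly_fin_two]
  simp only [Polynomial.eval_add, Polynomial.eval_sub, Polynomial.eval_mul, Polynomial.eval_pow, Polynomial.eval_X, Polynomial.eval_C]
  have hts : (g.trace * s) ^ 2 = g.trace ^ 2 - 4 * g.det := by
    have ht2 : g.trace ^ 2 ≠ 0 := pow_ne_zero _ ht0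
    rw [mul_pow, ← hs]
    field_simp
  have h4' : (4 : E) ≠ 0 := by rw [show (4 : E) = 2 * 2 by norm_num]; exact mul_ne_zero h20 h20
  have key : ((g.trace + g.trace * s) * 2⁻¹) ^ 2 - g.trace * ((g.trace + g.trace * s) * 2⁻¹) + g.det =
      ((g.trace * s) ^ 2 - (g.trace ^ 2 - 4 * g.det)) * 4⁻¹ := by
    field_simp
    ring
  rw [key, hts, sub_self, zero_mul]

end LocalField

end Literature.NumberTheory.Automorphic

/-! ## §2 At an inert place: unit determinant, the packaged type-(2) data -/

namespace Literature.NumberTheory.Automorphic.UnitaryGroup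

open Literature.NumberTheory.Rogawski1990

section CM

variable (L : Type) [Field L] [NumberField L] [IsCMField L] (v : HeightOneSpectrum (𝓞 ↥(maximalRealSubfield L)))
  (w : PlacesOver L v) (hw : IsCMField.complexConj L • w.1 = w.1)

include hw in
/-- **`|det γ_w| = 1` for `γ ∈ U(σ_w, (Φ₂)_w)`**: `ᵗσ(γ) Φ₂ γ = Φ₂` gives `σ(det γ) det γ = 1` (`det Φ₂ ≠ 0`), and a norm-one element has valuation one
(★ `valuation_eq_one_of_galAdicCompletionMap_mul_self`). [cite: Rogawski1990, §3.6 p. 31] -/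
theorem valuation_det_eq_one_of_mem (γ : ↥(unitaryGroupOfForm (galAdicCompletionMap (L := L) (IsCMField.complexConj L) hw) (placeForm (Matrix.of fun i j : Fin 2 => if i.val + j.val + 1 = 2 then (1 : L) else 0) w.1))) : valuation (w.1.adicCompletion L) (((γ : GL (Fin 2) (w.1.adicCompletion L))) : Matrix (Fin 2) (Fin 2) (w.1.adicCompletion L)).det = 1 := by
  have hγ := mem_unitaryGroupOfForm_iff.1 γ.2
  have h := congrArg Matrix.det hγ
  have hmd : ((((γ : GL (Fin 2) (w.1.adicCompletion L))) : Matrix (Fin 2) (Fin 2) (w.1.adicCompletion L)).map (galAdicCompletionMap (L := L) (IsCMField.complexConj L) hw)).det = (galAdicCompletionMap (L := L) (IsCMField.complexConj L) hw) (((γ : GL (Fin 2) (w.1.adicCompletion L))) : Matrix (Fin 2) (Fin 2) (w.1.adicCompletion L)).det := by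
    rw [← RingHom.mapMatrix_apply, ← RingHom.map_det]
  rw [Matrix.det_mul, Matrix.det_mul, Matrix.det_transpose, hmd] at h
  have hJ : (placeForm (Matrix.of fun i j : Fin 2 => if i.val + j.val + 1 = 2 then (1 : L) else 0) w.1).det ≠ 0 :=
    ((Matrix.isUnit_iff_isUnit_det _).1 (isUnit_placeForm_antidiagOne (E := L) 2 w.1)).ne_zero
  have h1 : (galAdicCompletionMap (L := L) (IsCMField.complexConj L) hw) (((γ : GL (Fin 2) (w.1.adicCompletion L))) : Matrix (Fin 2) (Fin 2) (w.1.adicCompletion L)).det * (((γ : GL (Fin 2) (w.1.adicCompletion L))) : Matrix (Fin 2) (Fin 2) (w.1.adicCompletion L)).det = 1 := by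
    apply mul_left_cancel₀ hJ
    linear_combination h
  exact valuation_eq_one_of_galAdicCompletionMap_mul_self L v w hw h1

include hw in
/-- **THE TYPE-(2) DATA OF `γ ∈ U₂` FROM `hirr`**: at `v` unramified and non-split in `L` with `2 ∈ 𝒪_w^×`, if `χ_{γ,w}` has no root in `L_w` then `|2|_w = 1`,
`tr γ_w ∈ 𝒪_w` (§1 with `|det γ_w| = 1`), and `|tr² − 4det|_w = exp(−(2N+1))` for some `N` (★ `exists_valued_disc_eq_exp_neg_odd_of_not_exists_isRoot` at `(γ, 1)`).
[cite: Rogawski1990, §3.6 p. 31] [cite: Kottwitz1988, §2] -/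
theorem typeTwo_sideConditions_of_not_exists_isRoot (hunr : Algebra.IsUnramifiedIn (𝓞 L) v.asIdeal) (h2 : IsUnit (2 : 𝒪[(w.1.adicCompletion L)]))
    (γ : ((cmDatum L 2 (Matrix.of fun i j : Fin 2 => if i.val + j.val + 1 = 2 then (1 : L) else 0)).Local v)) (hirr : ¬ ∃ x : (w.1.adicCompletion L), (((((localNonsplitEquiv (IsCMField.complexConj L) (Matrix.of fun i j : Fin 2 => if i.val + j.val + 1 = 2 then (1 : L) else 0) (IsCMField.complexConj_ne_one L) w hw) γ : ↥(unitaryGroupOfForm (galAdicCompletionMap (L := L) (IsCMField.complexConj L) hw) (placeForm (Matrix.of fun i j : Fin 2 => if i.val + j.val + 1 = 2 then (1 : L) else 0) w.1))) : GL (Fin 2) (w.1.adicCompletion L)) : Matrix (Fin 2) (Fin 2) (w.1.adicCompletion L)).charpoly).IsRoot x) :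
    valuation (w.1.adicCompletion L) 2 = 1 ∧ ((((localNonsplitEquiv (IsCMField.complexConj L) (Matrix.of fun i j : Fin 2 => if i.val + j.val + 1 = 2 then (1 : L) else 0) (IsCMField.complexConj_ne_one L) w hw) γ : ↥(unitaryGroupOfForm (galAdicCompletionMap (L := L) (IsCMField.complexConj L) hw) (placeForm (Matrix.of fun i j : Fin 2 => if i.val + j.val + 1 = 2 then (1 : L) else 0) w.1))) : GL (Fin 2) (w.1.adicCompletion L)) : Matrix (Fin 2) (Fin 2) (w.1.adicCompletion L)).trace ∈ 𝒪[(w.1.adicCompletion L)] ∧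
      ∃ N : ℕ, Valued.v (((((localNonsplitEquiv (IsCMField.complexConj L) (Matrix.of fun i j : Fin 2 => if i.val + j.val + 1 = 2 then (1 : L) else 0) (IsCMField.complexConj_ne_one L) w hw) γ : ↥(unitaryGroupOfForm (galAdicCompletionMap (L := L) (IsCMField.complexConj L) hw) (placeForm (Matrix.of fun i j : Fin 2 => if i.val + j.val + 1 = 2 then (1 : L) else 0) w.1))) : GL (Fin 2) (w.1.adicCompletion L)) : Matrix (Fin 2) (Fin 2) (w.1.adicCompletion L)).trace ^ 2 - 4 * ((((localNonsplitEquiv (IsCMField.complexConj L) (Matrix.of fun i j : Fin 2 => if i.val + j.val + 1 = 2 then (1 : L) else 0) (IsCMField.complexConj_ne_one L) w hw) γ : ↥(unitaryGroupOfForm (galAdicCompletionMap (L := L) (IsCMField.complexConj L) hw) (placeForm (Matrix.of fun i j : Fin 2 => if i.val + j.val + 1 = 2 then (1 : L) else 0) w.1))) : GL (Fin 2) (w.1.adicCompletion L)) : Matrix (Fin 2) (Fin 2) (w.1.adicCompletion L)).det) = WithZero.exp (-((2 * N + 1 : ℕ) : ℤ)) := by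
  -- `|2| = 1` in both valuation dialects (`h2` is the `ValuativeRel` unit; ★ `exists_valued_disc_…` wants the `Valued.integer` unit)
  have h2v : valuation (w.1.adicCompletion L) 2 = 1 := by
    have := (Valuation.integer.integers (valuation (w.1.adicCompletion L))).isUnit_iff_valuation_eq_one.1 h2
    rwa [map_ofNat] at this
  have h2' : Valued.v (2 : w.1.adicCompletion L) = 1 := (v_eq_one_iff_valuation_eq_one _).2 h2v
  have h2V : IsUnit (2 : Valued.integer (w.1.adicCompletion L)) :=
    (Valuation.integer.integers (Valued.v (R := w.1.adicCompletion L))).isUnit_iff_valuation_eq_one.2 (by rw [map_ofNat]; exact h2')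
  have hdet := valuation_det_eq_one_of_mem L v w hw ((localNonsplitEquiv (IsCMField.complexConj L) (Matrix.of fun i j : Fin 2 => if i.val + j.val + 1 = 2 then (1 : L) else 0) (IsCMField.complexConj_ne_one L) w hw) γ)
  have htr := valuation_trace_le_one_of_not_exists_isRoot h2v _ hdet.le hirr
  have htr' : Valued.v ((((localNonsplitEquiv (IsCMField.complexConj L) (Matrix.of fun i j : Fin 2 => if i.val + j.val + 1 = 2 then (1 : L) else 0) (IsCMField.complexConj_ne_one L) w hw) γ : ↥(unitaryGroupOfForm (galAdicCompletionMap (L := L) (IsCMField.complexConj L) hw) (placeForm (Matrix.of fun i j : Fin 2 => if i.val + j.val + 1 = 2 then (1 : L) else 0) w.1))) : GL (Fin 2) (w.1.adicCompletion L)) : Matrix (Fin 2) (Fin 2) (w.1.adicCompletion L)).trace ≤ 1 := (v_le_one_iff_valuation_le_one _).2 htr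
  have hdet' : Valued.v ((((localNonsplitEquiv (IsCMField.complexConj L) (Matrix.of fun i j : Fin 2 => if i.val + j.val + 1 = 2 then (1 : L) else 0) (IsCMField.complexConj_ne_one L) w hw) γ : ↥(unitaryGroupOfForm (galAdicCompletionMap (L := L) (IsCMField.complexConj L) hw) (placeForm (Matrix.of fun i j : Fin 2 => if i.val + j.val + 1 = 2 then (1 : L) else 0) w.1))) : GL (Fin 2) (w.1.adicCompletion L)) : Matrix (Fin 2) (Fin 2) (w.1.adicCompletion L)).det ≤ 1 := (v_le_one_iff_valuation_le_one _).2 hdet.le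
  obtain ⟨N, hN⟩ := exists_valued_disc_eq_exp_neg_odd_of_not_exists_isRoot L v w hw hunr h2V (γH := (γ, (1 : ((cmDatum L 1 (Matrix.of fun i j : Fin 1 => if i.val + j.val + 1 = 1 then (1 : L) else 0)).Local v)))) hirr htr' hdet'
  exact ⟨h2v, (Valuation.mem_integer_iff _ _).2 htr, N, hN⟩

include hw in
/-- **KOTTWITZ'S TYPE-(2) ELLIPTIC RELATION FROM `hirr` ALONE** — ★ (R5c′) `natCard_fixedBy_add_eq_natCard_fixedBy_add_one_of_not_exists_isRoot` with its side conditions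
discharged by `typeTwo_sideConditions_of_not_exists_isRoot`: at `v` unramified and non-split in `L` with `2 ∈ 𝒪_w^×`, for subgroups `C, C′, I ≤ U₂` characterised at `w`
by `GL₂(𝒪_w)`, `d GL₂(𝒪_w) d⁻¹` (`d = diag(1, ϖ)`, `σ_w ϖ = ϖ`) and the Iwahori, and `γ ∈ U₂` with ROOTLESS `χ_{γ,w}`:
`#Fix(U₂ ⧸ C, γ) + #Fix(U₂ ⧸ C′, γ) = #Fix(U₂ ⧸ I, γ) + 1`. [cite: Kottwitz1988, §2 Theorem 2] [cite: Rogawski1990, §12.6 p. 174] -/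
theorem natCard_fixedBy_add_eq_natCard_fixedBy_add_one_of_not_exists_isRoot' (hunr : Algebra.IsUnramifiedIn (𝓞 L) v.asIdeal)
    (h2 : IsUnit (2 : 𝒪[(w.1.adicCompletion L)]))
    (ϖ : (w.1.adicCompletion L)ˣ) (hσϖ : (galAdicCompletionMap (L := L) (IsCMField.complexConj L) hw) (ϖ : (w.1.adicCompletion L)) = ϖ)
    (C C' I : Subgroup ((cmDatum L 2 (Matrix.of fun i j : Fin 2 => if i.val + j.val + 1 = 2 then (1 : L) else 0)).Local v))
    (hC : ∀ g, g ∈ C ↔ (((localNonsplitEquiv (IsCMField.complexConj L) (Matrix.of fun i j : Fin 2 => if i.val + j.val + 1 = 2 then (1 : L) else 0) (IsCMField.complexConj_ne_one L) w hw) g : ↥(unitaryGroupOfForm (galAdicCompletionMap (L := L) (IsCMField.complexConj L) hw) (placeForm (Matrix.of fun i j : Fin 2 => if i.val + j.val + 1 = 2 then (1 : L) else 0) w.1))) : GL (Fin 2) (w.1.adicCompletion L)) ∈ glInt 2 (w.1.adicCompletion L))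
    (hC' : ∀ g, g ∈ C' ↔ (((localNonsplitEquiv (IsCMField.complexConj L) (Matrix.of fun i j : Fin 2 => if i.val + j.val + 1 = 2 then (1 : L) else 0) (IsCMField.complexConj_ne_one L) w hw) g : ↥(unitaryGroupOfForm (galAdicCompletionMap (L := L) (IsCMField.complexConj L) hw) (placeForm (Matrix.of fun i j : Fin 2 => if i.val + j.val + 1 = 2 then (1 : L) else 0) w.1))) : GL (Fin 2) (w.1.adicCompletion L)) ∈ (glInt 2 (w.1.adicCompletion L)).map (MulAut.conj (glDiagonal 2 (w.1.adicCompletion L) ![1, ϖ])).toMonoidHom)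
    (hI : ∀ g, g ∈ I ↔ (((localNonsplitEquiv (IsCMField.complexConj L) (Matrix.of fun i j : Fin 2 => if i.val + j.val + 1 = 2 then (1 : L) else 0) (IsCMField.complexConj_ne_one L) w hw) g : ↥(unitaryGroupOfForm (galAdicCompletionMap (L := L) (IsCMField.complexConj L) hw) (placeForm (Matrix.of fun i j : Fin 2 => if i.val + j.val + 1 = 2 then (1 : L) else 0) w.1))) : GL (Fin 2) (w.1.adicCompletion L)) ∈ iwahoriGL 2 (w.1.adicCompletion L))
    (γ : ((cmDatum L 2 (Matrix.of fun i j : Fin 2 => if i.val + j.val + 1 = 2 then (1 : L) else 0)).Local v)) (hirr : ¬ ∃ x : (w.1.adicCompletion L), (((((localNonsplitEquiv (IsCMField.complexConj L) (Matrix.of fun i j : Fin 2 => if i.val + j.val + 1 = 2 then (1 : L) else 0) (IsCMField.complexConj_ne_one L) w hw) γ : ↥(unitaryGroupOfForm (galAdicCompletionMap (L := L) (IsCMField.complexConj L) hw) (placeForm (Matrix.of fun i j : Fin 2 => if i.val + j.val + 1 = 2 then (1 : L) else 0) w.1))) : GL (Fin 2) (w.1.adicCompletion L)) : Matrix (Fin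 2) (Fin 2) (w.1.adicCompletion L)).charpoly).IsRoot x) :
    Nat.card (fixedBy (((cmDatum L 2 (Matrix.of fun i j : Fin 2 => if i.val + j.val + 1 = 2 then (1 : L) else 0)).Local v) ⧸ C) γ) + Nat.card (fixedBy (((cmDatum L 2 (Matrix.of fun i j : Fin 2 => if i.val + j.val + 1 = 2 then (1 : L) else 0)).Local v) ⧸ C') γ) = Nat.card (fixedBy (((cmDatum L 2 (Matrix.of fun i j : Fin 2 => if i.val + j.val + 1 = 2 then (1 : L) else 0)).Local v) ⧸ I) γ) + 1 := by
  obtain ⟨h2v, ht, N, hN⟩ := typeTwo_sideConditions_of_not_exists_isRoot L v w hw hunr h2 γ hirr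
  exact natCard_fixedBy_add_eq_natCard_fixedBy_add_one_of_not_exists_isRoot L v w hw hunr ϖ hσϖ C C' I hC hC' hI γ h2v ht hirr N hN

end CM

end Literature.NumberTheory.Automorphic.UnitaryGroup

end
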